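import Summits.NavierStokesRegularity.FunctionalMining.NoGo.TopEigHeatVectorLaminateMean
import Summits.NavierStokesRegularity.FunctionalMining.NoGo.StrainMomentLtTwoRadial
import Summits.NavierStokesRegularity.FunctionalMining.NoGo.StrainMomentHeatCoerciveLtTwo
import Summits.NavierStokesRegularity.FunctionalMining.TopEigLaminateRigid
import Summits.NavierStokesRegularity.FunctionalMining.TopEigHeatConvex
import Summits.NavierStokesRegularity.FunctionalMining.TopEigHeatCoerciveGap
import HarnessLib

/-!
# FunctionalMining / NoGo — heat-flow coercivity of `Φ_q = ∫(λ₁⁺)^q`, `∫((−λ₃)⁺)^q` on the class of ALL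
# laminates `u = A(k·x)`, for every real `q > 1` (door (c), node K6, Lemma L-λ(q); file 3 of 3)

search for candidate a priori estimates; no regularity claim. Cell `pub-nsfunc`, nogo seat (gen 47),
file K38c. Static calculus of explicit smooth periodic fields on `T³`; nothing about Navier–Stokes dynamics.

What is proved (kernel-checked, standard axioms), with `IsLaminate v :⇔ v = lamV k A`, `k ∈ ℤ³ ∖ 0`,
`A : Fin 3 → ShearProfile`, `Σᵢ kᵢ Aᵢ′ ≡ 0` (the class of `TopEigLaminateRigid`; it contains every
`x₂`-laminate, every laminate Beltrami field and the `K34/K35` families) and the explicit rate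
`vlamRate q = 6q·min(1, q−1) / max(1, q²/4)` (`= 6q(q−1)` for `1 < q ≤ 2`, `= 24/q` for `q ≥ 2`):
* `vlaminate_coercive_gt_one`: `vlamRate q · Φ_q(u) ≤ heatDissipation Φ_q u` for every laminate `u` and
  every real `q > 1`, both cores;
* `heatCoerciveOn_isLaminate_gt_one`: `HeatCoerciveOn IsLaminate Φ_q (vlamRate q)`, both cores — the tree
  (`heatCoerciveOn_isLaminate_two`, `q = 2`, rate `8π²`) and staged K36 (`q ≥ 2`, non-explicit rate) are extended
  in `q`-RANGE to EVERY real `q > 1`, incl. the singular range `1 < q < 2` (at `q = 2`: `vlamRate 2 = 12 < 8π²`);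
* `kill_not_isLaminate_gt_one`: a field with `heatDissipation Φ_q v < c·Φ_q v` for some `c ≤ vlamRate q` is
  NOT a laminate — a refutation of `TopEigHeatCoercivePos q` (OPEN for every real `q > 1`; FALSE at `q = 1`,
  K32) needs a genuinely non-laminate family. The rate `→ 0` as `q → 1⁺` (consistent with K32) and is not
  claimed sharp (the `x₂`-laminate sub-class has `4π²(q−1)/q`, K37).

Method. Along the heat line `u + tΔu = (A′ + t|k|²A‴)(k·x)`-laminate, `Φ_q(u + tΔu) =
(|k|²/4)^{q/2} ∫₀¹ W_{t|k|²}^{q/2}` with the squared vector profile `W_c = Σᵢ(Aᵢ′ + cAᵢ‴)²` (§1, from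
`lam_sq_line_V`); the vector tangent inequality of `x ↦ |x|^q` (file 1, `tangent_sumSq_rpow`: Bernoulli +
Cauchy–Schwarz, in coordinates) squeezes the right derivative of the convex heat line
(`TopEig.heatDissipation_topEigMoment_eq`) to `−(|k|²/4)^{q/2}|k|²·vPairing A q 0 0` (§2–§3; joint continuity
of the regularised integrand from K11a `TopEig.continuous_rpow_normSq_add_sq_smul`); the `η`-regularised
mean-defect Poincaré chain of K38b (`vlam_regularised_coercive`, `η ≠ 0`) passes to `η → 0⁺` by continuity
(§4, K11d `TopEig.const_le_of_forall_pos_le`); assembly in §5 (`|k|² ≥ 1`). [ours, calibration]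
search for candidate a priori estimates; no regularity claim.
FILING (prove seat g28, REQUEST #59): declarations byte-identical to the no-go seat's staged `TopEigHeatVectorLaminate.STAGING.lean` f466fa7b822dfbc3; this line is the only addition (re-cut from the v2 restage).
-/

noncomputable section

open MeasureTheory Set intervalIntegral Real Filter
open scoped Topology

namespace Summit.NavierStokesRegularity.FunctionalMining
open Literature.Analysis Literature.Analysis.FunctionSpaces Literature.Analysis.FunctionSpaces.Torus
open TopEig StrainL4 LaminateDirection

namespace TopEigLaminate

variable {k : Fin 3 → ℤ} (A : Fin 3 → ShearProfile)

/-! ## 1. The `q`-th moments along the heat line of a laminate -/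

/-- **`Φ_q(u + tΔu) = ∫₀¹ ((|k|²/4)·W_{t|k|²}(s))^{q/2} ds`** for the laminate `u = lamV k A`, both cores, every
real `q > 0`. [ours] -/
theorem topEigMoment_line_V_rpow (hk : k ≠ 0) (hdiv : ∀ s : ℝ, ∑ i, (k i : ℝ) * (A i).D s = 0) {q : ℝ}
    (hq : 0 < q) (t : ℝ) :
    torusTopEigMoment q (lamV k A + t • Torus.laplacian (lamV k A)) =
        ∫ s in (0 : ℝ)..1, ((kR k ⬝ᵥ kR k) / 4 * vW A (t * (kR k ⬝ᵥ kR k)) s) ^ (q / 2) ∧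
      torusNegBotEigMoment q (lamV k A + t • Torus.laplacian (lamV k A)) =
        ∫ s in (0 : ℝ)..1, ((kR k ⬝ᵥ kR k) / 4 * vW A (t * (kR k ⬝ᵥ kR k)) s) ^ (q / 2) := by
  have hq2 : 0 ≤ q / 2 := by positivity
  have hD : ∫ x, lineDensity k A t (dirForm k x) ^ (q / 2) =
      ∫ s in (0 : ℝ)..1, ((kR k ⬝ᵥ kR k) / 4 * vW A (t * (kR k ⬝ᵥ kR k)) s) ^ (q / 2) := by
    rw [integral_comp_dirForm hk (F := fun y => lineDensity k A t y ^ (q / 2))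
        (((continuous_lineDensity (k := k) (A := A) t).rpow_const fun _ => Or.inr hq2).aestronglyMeasurable),
      CellularStretching.integral_circle_eq_intervalIntegral]
    refine intervalIntegral.integral_congr fun s _ => ?_
    simp only [lineDensity_coe, vW_expand]
  have hpow : ∀ {l L : ℝ}, 0 ≤ l → l ^ 2 = L → l ^ q = L ^ (q / 2) := by
    intro l L hl h
    rw [← h, ← Real.rpow_natCast, ← Real.rpow_mul hl]
    congr 1; push_cast; ring
  constructor
  · rw [← hD]
    unfold torusTopEigMoment
    refine integral_congr_ae (ae_of_all _ fun x => ?_)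
    obtain ⟨h1, -, h3, -⟩ := lam_sq_line_V hdiv t x
    dsimp only
    rw [← lam_strainFlat, max_eq_left h3, hpow h3 h1]
  · rw [← hD]
    unfold torusNegBotEigMoment
    refine integral_congr_ae (ae_of_all _ fun x => ?_)
    obtain ⟨-, h2, -, h4⟩ := lam_sq_line_V hdiv t x
    dsimp only
    rw [← lam_neg_strainFlat, max_eq_left h4, hpow h4 h2]

/-- Pulling the factor `(m/4)^{q/2}` out of the line integral. [ours; bookkeeping] -/
theorem integral_line_factor (q c : ℝ) {m : ℝ} (hm : 0 ≤ m) :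
    ∫ s in (0 : ℝ)..1, (m / 4 * vW A c s) ^ (q / 2) =
      (m / 4) ^ (q / 2) * ∫ s in (0 : ℝ)..1, vW A c s ^ (q / 2) := by
  rw [← intervalIntegral.integral_const_mul]
  exact intervalIntegral.integral_congr fun s _ => Real.mul_rpow (by positivity) (vW_nonneg A c s)

/-! ## 2. Continuity of the regularised pairing -/

/-- **Joint continuity of `((η, c), s) ↦ (W_c(s) + η²)^β·(Aᵢ′(s) + cAᵢ‴(s))` for `β > −1/2`** — the `i`-th
coordinate of `(|P|² + η²)^β P`, `P = P_c(s)`; from K11a with the second variable `√(η² + Σ_{j≠i}P_j²)`.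
[ours] -/
theorem continuous_vRegCoord {β : ℝ} (hβ : -1 / 2 < β) (i : Fin 3) :
    Continuous fun p : (ℝ × ℝ) × ℝ =>
      (vW A p.1.2 p.2 + p.1.1 ^ 2) ^ β * ((A i).D p.2 + p.1.2 * (A i).D.D.D p.2) := by
  have hG : Continuous fun r : ℝ × ℝ => (r.2 ^ 2 + r.1 ^ 2) ^ β * r.2 :=
    (continuous_rpow_normSq_add_sq_smul (E := ℝ) hβ).congr fun r => by
      simp only [Real.norm_eq_abs, sq_abs, smul_eq_mul]
  have hP : ∀ j, Continuous fun p : (ℝ × ℝ) × ℝ => (A j).D p.2 + p.1.2 * (A j).D.D.D p.2 := fun j => by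
    have h1 := (A j).D.continuous; have h3 := (A j).D.D.D.continuous; fun_prop
  have hWc : Continuous fun p : (ℝ × ℝ) × ℝ => vW A p.1.2 p.2 + p.1.1 ^ 2 := by
    have : Continuous fun p : (ℝ × ℝ) × ℝ => vW A p.1.2 p.2 := by
      simp only [vW]; exact continuous_finsetSum _ fun j _ => (hP j).pow 2
    exact this.add (by fun_prop)
  have hle : ∀ p : (ℝ × ℝ) × ℝ, ((A i).D p.2 + p.1.2 * (A i).D.D.D p.2) ^ 2 ≤ vW A p.1.2 p.2 := fun p =>
    Finset.single_le_sum (f := fun j => ((A j).D p.2 + p.1.2 * (A j).D.D.D p.2) ^ 2)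
      (fun j _ => sq_nonneg _) (Finset.mem_univ i)
  have hρ : Continuous fun p : (ℝ × ℝ) × ℝ =>
      Real.sqrt (vW A p.1.2 p.2 + p.1.1 ^ 2 - ((A i).D p.2 + p.1.2 * (A i).D.D.D p.2) ^ 2) :=
    (hWc.sub ((hP i).pow 2)).sqrt
  refine (hG.comp (hρ.prodMk (hP i))).congr fun p => ?_
  have h0 : 0 ≤ vW A p.1.2 p.2 + p.1.1 ^ 2 - ((A i).D p.2 + p.1.2 * (A i).D.D.D p.2) ^ 2 := by
    nlinarith [hle p, sq_nonneg p.1.1]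
  have e : ((A i).D p.2 + p.1.2 * (A i).D.D.D p.2) ^ 2 +
      (vW A p.1.2 p.2 + p.1.1 ^ 2 - ((A i).D p.2 + p.1.2 * (A i).D.D.D p.2) ^ 2) =
        vW A p.1.2 p.2 + p.1.1 ^ 2 := by ring
  simp only [Function.comp_apply, Real.sq_sqrt h0, e]

/-- **Joint continuity of the integrand of `vPairing` in `((η, c), s)`** for `q > 1`. [ours] -/
theorem continuous_vIntegrand {q : ℝ} (hq : 1 < q) :
    Continuous fun p : (ℝ × ℝ) × ℝ => q * ((vW A p.1.2 p.2 + p.1.1 ^ 2) ^ ((q - 2) / 2) *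
      ∑ i, ((A i).D p.2 + p.1.2 * (A i).D.D.D p.2) * (A i).D.D.D p.2) := by
  have hβ : -1 / 2 < (q - 2) / 2 := by linarith
  have h : Continuous fun p : (ℝ × ℝ) × ℝ => q * ∑ i, (vW A p.1.2 p.2 + p.1.1 ^ 2) ^ ((q - 2) / 2) *
      ((A i).D p.2 + p.1.2 * (A i).D.D.D p.2) * (A i).D.D.D p.2 :=
    continuous_const.mul (continuous_finsetSum Finset.univ fun i _ =>
      (continuous_vRegCoord A hβ i).mul ((A i).D.D.D.continuous.comp continuous_snd))
  refine h.congr fun p => ?_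
  rw [Finset.mul_sum, Finset.mul_sum, Finset.mul_sum]
  exact Finset.sum_congr rfl fun i _ => by ring

/-- `c ↦ vPairing A q η c` is continuous (`q > 1`). [ours] -/
theorem continuous_vPairing_right {q : ℝ} (hq : 1 < q) (η : ℝ) : Continuous fun c : ℝ => vPairing A q η c := by
  have hf : Continuous fun p : ℝ × ℝ => q * ((vW A p.1 p.2 + η ^ 2) ^ ((q - 2) / 2) *
      ∑ i, ((A i).D p.2 + p.1 * (A i).D.D.D p.2) * (A i).D.D.D p.2) :=
    (continuous_vIntegrand A hq).comp' (f := fun p : ℝ × ℝ => ((η, p.1), p.2)) (by fun_prop)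
  exact intervalIntegral.continuous_parametric_intervalIntegral_of_continuous'
    (f := fun c s => q * ((vW A c s + η ^ 2) ^ ((q - 2) / 2) *
      ∑ i, ((A i).D s + c * (A i).D.D.D s) * (A i).D.D.D s)) hf 0 1

/-- `η ↦ vPairing A q η c` is continuous (`q > 1`). [ours] -/
theorem continuous_vPairing_left {q : ℝ} (hq : 1 < q) (c : ℝ) : Continuous fun η : ℝ => vPairing A q η c := by
  have hf : Continuous fun p : ℝ × ℝ => q * ((vW A c p.2 + p.1 ^ 2) ^ ((q - 2) / 2) *
      ∑ i, ((A i).D p.2 + c * (A i).D.D.D p.2) * (A i).D.D.D p.2) :=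
    (continuous_vIntegrand A hq).comp' (f := fun p : ℝ × ℝ => ((p.1, c), p.2)) (by fun_prop)
  exact intervalIntegral.continuous_parametric_intervalIntegral_of_continuous'
    (f := fun η s => q * ((vW A c s + η ^ 2) ^ ((q - 2) / 2) *
      ∑ i, ((A i).D s + c * (A i).D.D.D s) * (A i).D.D.D s)) hf 0 1

/-- The `η = 0` slice of the integrand is continuous in `s`. [ours; bookkeeping] -/
theorem continuous_vIntegrand_zero {q : ℝ} (hq : 1 < q) (c : ℝ) :
    Continuous fun s : ℝ => q * (vW A c s ^ ((q - 2) / 2) *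
      ∑ i, ((A i).D s + c * (A i).D.D.D s) * (A i).D.D.D s) := by
  have h := (continuous_vIntegrand A hq).comp' (f := fun s : ℝ => (((0 : ℝ), c), s)) (by fun_prop)
  simpa using h

/-- `vPairing` at `η = 0`. [ours; bookkeeping] -/
theorem vPairing_zero_left (q c : ℝ) : vPairing A q 0 c =
    ∫ s in (0 : ℝ)..1, q * (vW A c s ^ ((q - 2) / 2) * ∑ i, ((A i).D s + c * (A i).D.D.D s) * (A i).D.D.D s) := by
  simp [vPairing]

/-- `s ↦ W_c(s)^{q/2}` is continuous. [ours; bookkeeping] -/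
theorem continuous_vW_rpow (c r : ℝ) (hr : 0 ≤ r) : Continuous fun s : ℝ => vW A c s ^ r := by
  have hP : ∀ j, Continuous fun s : ℝ => (A j).D s + c * (A j).D.D.D s := fun j => by
    have h1 := (A j).D.continuous; have h3 := (A j).D.D.D.continuous; fun_prop
  have : Continuous fun s : ℝ => vW A c s := by
    simp only [vW]; exact continuous_finsetSum _ fun j _ => (hP j).pow 2
  exact this.rpow_const fun _ => Or.inr hr

/-! ## 3. The tangent squeeze and the right derivative of the heat line -/

/-- **Tangent bounds**: `c·vPairing A q 0 0 ≤ ∫W_c^{q/2} − ∫W_0^{q/2} ≤ c·vPairing A q 0 c`. [ours] -/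
theorem integral_vW_rpow_bounds {q : ℝ} (hq : 1 < q) (c : ℝ) :
    (∫ s in (0 : ℝ)..1, vW A 0 s ^ (q / 2)) + c * vPairing A q 0 0 ≤ ∫ s in (0 : ℝ)..1, vW A c s ^ (q / 2) ∧
      ∫ s in (0 : ℝ)..1, vW A c s ^ (q / 2) ≤
        (∫ s in (0 : ℝ)..1, vW A 0 s ^ (q / 2)) + c * vPairing A q 0 c := by
  have hq2 : 0 ≤ q / 2 := by linarith
  have i0 := fun c' => (continuous_vW_rpow A c' (q / 2) hq2).intervalIntegrable 0 1 (μ := volume)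
  have iP := fun c' => (continuous_vIntegrand_zero A hq c').intervalIntegrable 0 1 (μ := volume)
  have hWdef : ∀ c' s, vW A c' s = ∑ i, ((A i).D s + c' * (A i).D.D.D s) ^ 2 := fun _ _ => rfl
  constructor
  · rw [vPairing_zero_left, ← intervalIntegral.integral_const_mul, ← intervalIntegral.integral_add (i0 0)
      ((iP 0).const_mul c)]
    refine intervalIntegral.integral_mono_on zero_le_one ((i0 0).add ((iP 0).const_mul c)) (i0 c)
      fun s _ => ?_
    have ht := tangent_sumSq_rpow hq.le (fun i => (A i).D s) (fun i => (A i).D s + c * (A i).D.D.D s)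
    beta_reduce at ht
    have e : ∑ i, (A i).D s * ((A i).D s + c * (A i).D.D.D s - (A i).D s) =
        c * ∑ i, ((A i).D s + 0 * (A i).D.D.D s) * (A i).D.D.D s := by
      rw [Finset.mul_sum]; exact Finset.sum_congr rfl fun i _ => by ring
    have e0 : ∑ i, (A i).D s ^ 2 = vW A 0 s := by
      rw [hWdef]; exact Finset.sum_congr rfl fun i _ => by ring
    rw [e, e0, ← hWdef] at ht
    nlinarith [ht]
  · rw [vPairing_zero_left, ← intervalIntegral.integral_const_mul, ← intervalIntegral.integral_add (i0 0)
      ((iP c).const_mul c)]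
    refine intervalIntegral.integral_mono_on zero_le_one (i0 c) ((i0 0).add ((iP c).const_mul c))
      fun s _ => ?_
    have ht := tangent_sumSq_rpow hq.le (fun i => (A i).D s + c * (A i).D.D.D s) (fun i => (A i).D s)
    beta_reduce at ht
    have e : ∑ i, ((A i).D s + c * (A i).D.D.D s) * ((A i).D s - ((A i).D s + c * (A i).D.D.D s)) =
        -(c * ∑ i, ((A i).D s + c * (A i).D.D.D s) * (A i).D.D.D s) := by
      rw [Finset.mul_sum, ← Finset.sum_neg_distrib]; exact Finset.sum_congr rfl fun i _ => by ring
    have e0 : ∑ i, (A i).D s ^ 2 = vW A 0 s := by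
      rw [hWdef]; exact Finset.sum_congr rfl fun i _ => by ring
    rw [e, e0, ← hWdef] at ht
    nlinarith [ht]

/-- **Identification of the right derivative of the heat line by the tangent squeeze**: if
`M t = L·∫₀¹ W_{tm}^{q/2}` (`L ≥ 0`) has right derivative `m'` at `0`, then `m' = L·m·vPairing A q 0 0`. [ours] -/
theorem rightDeriv_line_eq_vPairing {q : ℝ} (hq : 1 < q) {L m : ℝ} (hL : 0 ≤ L) {M : ℝ → ℝ} {m' : ℝ}
    (hline : ∀ t, M t = L * ∫ s in (0 : ℝ)..1, vW A (t * m) s ^ (q / 2))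
    (hderiv : HasDerivWithinAt M m' (Set.Ioi 0) 0) : m' = L * (m * vPairing A q 0 0) := by
  have hM0 : M 0 = L * ∫ s in (0 : ℝ)..1, vW A 0 s ^ (q / 2) := by rw [hline 0]; simp only [zero_mul]
  have ht : Tendsto (slope M 0) (𝓝[Set.Ioi 0] 0) (𝓝 m') :=
    (hasDerivWithinAt_iff_tendsto_slope' (by simp)).1 hderiv
  have hslope : ∀ t : ℝ, 0 < t → slope M 0 t =
      L * ((∫ s in (0 : ℝ)..1, vW A (t * m) s ^ (q / 2)) - ∫ s in (0 : ℝ)..1, vW A 0 s ^ (q / 2)) / t := by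
    intro t _
    rw [slope_def_field, sub_zero, hline t, hM0]; ring
  have hlow : ∀ᶠ t in 𝓝[Set.Ioi 0] 0, L * (m * vPairing A q 0 0) ≤ slope M 0 t := by
    refine eventually_nhdsWithin_of_forall fun t (htp : 0 < t) => ?_
    rw [hslope t htp, le_div_iff₀ htp]
    have hb := mul_le_mul_of_nonneg_left (integral_vW_rpow_bounds A hq (t * m)).1 hL
    linarith [hb]
  have hup : ∀ᶠ t in 𝓝[Set.Ioi 0] 0, slope M 0 t ≤ L * (m * vPairing A q 0 (t * m)) := by
    refine eventually_nhdsWithin_of_forall fun t (htp : 0 < t) => ?_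
    rw [hslope t htp, div_le_iff₀ htp]
    have hb := mul_le_mul_of_nonneg_left (integral_vW_rpow_bounds A hq (t * m)).2 hL
    linarith [hb]
  have hJ : Continuous fun t : ℝ => vPairing A q 0 (t * m) :=
    (continuous_vPairing_right A hq 0).comp' (continuous_id.mul continuous_const)
  have hU : Tendsto (fun t : ℝ => L * (m * vPairing A q 0 (t * m))) (𝓝[Set.Ioi 0] 0)
      (𝓝 (L * (m * vPairing A q 0 0))) := by
    have h : Tendsto (fun t : ℝ => L * (m * vPairing A q 0 (t * m))) (𝓝[Set.Ioi 0] 0)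
        (𝓝 (L * (m * vPairing A q 0 (0 * m)))) :=
      (((hJ.tendsto 0).mono_left nhdsWithin_le_nhds).const_mul m).const_mul L
    simpa only [zero_mul] using h
  exact tendsto_nhds_unique ht (tendsto_of_tendsto_of_tendsto_of_le_of_le' tendsto_const_nhds hU hlow hup)

/-- **The dissipation of `Φ_q` at a laminate**: `heatDissipation Φ_q (lamV k A) =
−(|k|²/4)^{q/2}·|k|²·vPairing A q 0 0`, both cores, `q > 1`. [ours] -/
theorem heatDissipation_lamV_eq {q : ℝ} (hq : 1 < q) (hk : k ≠ 0)
    (hdiv : ∀ s : ℝ, ∑ i, (k i : ℝ) * (A i).D s = 0) :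
    heatDissipation (torusTopEigMoment q) (lamV k A) =
        -((kR k ⬝ᵥ kR k / 4) ^ (q / 2) * ((kR k ⬝ᵥ kR k) * vPairing A q 0 0)) ∧
      heatDissipation (torusNegBotEigMoment q) (lamV k A) =
        -((kR k ⬝ᵥ kR k / 4) ^ (q / 2) * ((kR k ⬝ᵥ kR k) * vPairing A q 0 0)) := by
  have hq0 : 0 < q := by linarith
  have hm : 0 ≤ kR k ⬝ᵥ kR k := by have := one_le_kR_dot k hk; linarith
  have hL : 0 ≤ (kR k ⬝ᵥ kR k / 4) ^ (q / 2) := Real.rpow_nonneg (by positivity) _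
  constructor
  · obtain ⟨hd, he⟩ := heatDissipation_topEigMoment_eq hq.le (isSmooth_lamV k A)
    rw [he, rightDeriv_line_eq_vPairing A hq hL (fun t => ?_) hd]
    rw [(topEigMoment_line_V_rpow A hk hdiv hq0 t).1, integral_line_factor A q _ hm]
  · obtain ⟨hd, he⟩ := heatDissipation_negBotEigMoment_eq hq.le (isSmooth_lamV k A)
    rw [he, rightDeriv_line_eq_vPairing A hq hL (fun t => ?_) hd]
    rw [(topEigMoment_line_V_rpow A hk hdiv hq0 t).2, integral_line_factor A q _ hm]

/-! ## 4. The limit `η → 0⁺` -/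

/-- **Coercivity of the pairing along the line, every real `q > 1`**:
`6q·min(1,q−1)·∫₀¹ W_0^{q/2} ≤ max(1, q²/4)·(−vPairing A q 0 0)`. [ours] -/
theorem vlam_line_coercive {q : ℝ} (hq : 1 < q) :
    6 * q * min 1 (q - 1) * ∫ s in (0 : ℝ)..1, prof0 A s ^ (q / 2) ≤ max 1 (q ^ 2 / 4) * -vPairing A q 0 0 := by
  have hβ : -1 / 2 < (q - 2) / 2 := by linarith
  -- continuity of `η ↦ ∫ (W + η²)^β W`
  have hI : Continuous fun p : ℝ × ℝ => (prof0 A p.2 + p.1 ^ 2) ^ ((q - 2) / 2) * prof0 A p.2 := by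
    have h : ∀ i, Continuous fun p : ℝ × ℝ =>
        (vW A 0 p.2 + p.1 ^ 2) ^ ((q - 2) / 2) * ((A i).D p.2 + 0 * (A i).D.D.D p.2) * (A i).D p.2 :=
      fun i => ((continuous_vRegCoord A hβ i).comp' (f := fun p : ℝ × ℝ => ((p.1, (0 : ℝ)), p.2))
        (by fun_prop)).mul ((A i).D.continuous.comp continuous_snd)
    refine (continuous_finsetSum Finset.univ fun i _ => h i).congr fun p => ?_
    simp only [vW_zero, zero_mul, add_zero]
    rw [prof0, Finset.mul_sum]
    exact Finset.sum_congr rfl fun i _ => by ring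
  have hA : Continuous fun η : ℝ => ∫ s in (0 : ℝ)..1, (prof0 A s + η ^ 2) ^ ((q - 2) / 2) * prof0 A s :=
    intervalIntegral.continuous_parametric_intervalIntegral_of_continuous'
      (f := fun η s => (prof0 A s + η ^ 2) ^ ((q - 2) / 2) * prof0 A s) hI 0 1
  have hB := continuous_vPairing_left A hq 0
  have key := const_le_of_forall_pos_le (A := 0)
    (B := fun η => max 1 (q ^ 2 / 4) * -vPairing A q η 0 -
      6 * q * min 1 (q - 1) * ∫ s in (0 : ℝ)..1, (prof0 A s + η ^ 2) ^ ((q - 2) / 2) * prof0 A s)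
    (by fun_prop) fun η hη _ => sub_nonneg.2 (vlam_regularised_coercive A hη.ne' hq)
  have e0 : ∫ s in (0 : ℝ)..1, (prof0 A s + (0 : ℝ) ^ 2) ^ ((q - 2) / 2) * prof0 A s =
      ∫ s in (0 : ℝ)..1, prof0 A s ^ (q / 2) := by
    refine intervalIntegral.integral_congr fun s _ => ?_
    simp only [ne_eq, OfNat.ofNat_ne_zero, not_false_eq_true, zero_pow, add_zero]
    rcases (prof0_nonneg A s).eq_or_lt with h0 | hpos
    · rw [← h0, Real.zero_rpow (by linarith : q / 2 ≠ 0), mul_zero]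
    · rw [← Real.rpow_add_one hpos.ne']; congr 1; ring
  have hk := key
  simp only [e0] at hk
  linarith

/-! ## 5. Assembly: the class of all laminates, every real `q > 1` -/

/-- **The explicit rate** `vlamRate q = 6q·min(1, q−1)/max(1, q²/4)`. [ours] -/
def vlamRate (q : ℝ) : ℝ := 6 * q * min 1 (q - 1) / max 1 (q ^ 2 / 4)

/-- `0 < vlamRate q` for `q > 1`. [bookkeeping] -/
theorem vlamRate_pos {q : ℝ} (hq : 1 < q) : 0 < vlamRate q :=
  div_pos (mul_pos (by linarith) (lt_min one_pos (by linarith))) (lt_max_of_lt_left one_pos)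

/-- `vlamRate q = 6q(q−1)` on `1 ≤ q ≤ 2`. [ours; bookkeeping] -/
theorem vlamRate_of_le_two {q : ℝ} (h1 : 1 ≤ q) (h2 : q ≤ 2) : vlamRate q = 6 * q * (q - 1) := by
  have hmin : min 1 (q - 1) = q - 1 := min_eq_right (by linarith)
  have hmax : max 1 (q ^ 2 / 4) = 1 := max_eq_left (by nlinarith)
  rw [vlamRate, hmin, hmax, div_one]

/-- `vlamRate q = 24/q` on `q ≥ 2`. [ours; bookkeeping] -/
theorem vlamRate_of_two_le {q : ℝ} (h2 : 2 ≤ q) : vlamRate q = 24 / q := by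
  have hmin : min 1 (q - 1) = 1 := min_eq_left (by linarith)
  have hmax : max 1 (q ^ 2 / 4) = q ^ 2 / 4 := max_eq_right (by nlinarith)
  rw [vlamRate, hmin, hmax]
  field_simp
  ring

/-- **Every laminate satisfies the coercivity inequality at rate `vlamRate q`, every real `q > 1`, both
cores.** [ours] -/
theorem vlaminate_coercive_gt_one {q : ℝ} (hq : 1 < q) (hk : k ≠ 0)
    (hdiv : ∀ s : ℝ, ∑ i, (k i : ℝ) * (A i).D s = 0) :
    vlamRate q * torusTopEigMoment q (lamV k A) ≤ heatDissipation (torusTopEigMoment q) (lamV k A) ∧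
      vlamRate q * torusNegBotEigMoment q (lamV k A) ≤ heatDissipation (torusNegBotEigMoment q) (lamV k A) := by
  have hq0 : 0 < q := by linarith
  have hm1 : 1 ≤ kR k ⬝ᵥ kR k := one_le_kR_dot k hk
  have hm : 0 ≤ kR k ⬝ᵥ kR k := by linarith
  set L := (kR k ⬝ᵥ kR k / 4) ^ (q / 2) with hLdef
  have hL : 0 ≤ L := Real.rpow_nonneg (by positivity) _
  set I := ∫ s in (0 : ℝ)..1, prof0 A s ^ (q / 2) with hIdef
  have hI : 0 ≤ I := intervalIntegral.integral_nonneg zero_le_one fun s _ => Real.rpow_nonneg (prof0_nonneg A s) _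
  -- the moments at `t = 0`
  have h0 := topEigMoment_line_V_rpow A hk hdiv hq0 0
  simp only [zero_smul, add_zero, zero_mul] at h0
  rw [integral_line_factor A q 0 hm] at h0
  simp only [vW_zero] at h0
  -- the pairing bound
  have hpair : vlamRate q * I ≤ -vPairing A q 0 0 := by
    have h := vlam_line_coercive A hq
    have hmax : 0 < max 1 (q ^ 2 / 4) := lt_max_of_lt_left one_pos
    rw [vlamRate, div_mul_eq_mul_div, div_le_iff₀ hmax]
    linarith
  have hP : 0 ≤ -vPairing A q 0 0 := le_trans (mul_nonneg (vlamRate_pos hq).le hI) hpair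
  obtain ⟨hd1, hd2⟩ := heatDissipation_lamV_eq A hq hk hdiv
  have main : vlamRate q * (L * I) ≤ -(L * ((kR k ⬝ᵥ kR k) * vPairing A q 0 0)) := by
    have h1 : vlamRate q * (L * I) ≤ L * -vPairing A q 0 0 := by
      nlinarith [mul_le_mul_of_nonneg_left hpair hL]
    have h2 : L * -vPairing A q 0 0 ≤ L * ((kR k ⬝ᵥ kR k) * -vPairing A q 0 0) :=
      mul_le_mul_of_nonneg_left (by nlinarith) hL
    linarith
  exact ⟨by rw [h0.1, hd1]; exact main, by rw [h0.2, hd2]; exact main⟩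

/-- **Heat-flow coercivity of `Φ_q` on the class of all laminates, every real `q > 1`, both cores** —
extends `heatCoerciveOn_isLaminate_two` (`q = 2`) to all `q > 1` with an explicit rate. [ours] -/
theorem heatCoerciveOn_isLaminate_gt_one {q : ℝ} (hq : 1 < q) :
    HeatCoerciveOn (d := Fin 3) IsLaminate (torusTopEigMoment q) (vlamRate q) ∧
      HeatCoerciveOn (d := Fin 3) IsLaminate (torusNegBotEigMoment q) (vlamRate q) := by
  constructor
  · rintro - v - - - ⟨k, A, hk, hdiv, rfl⟩
    exact (vlaminate_coercive_gt_one A hq hk hdiv).1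
  · rintro - v - - - ⟨k, A, hk, hdiv, rfl⟩
    exact (vlaminate_coercive_gt_one A hq hk hdiv).2

/-- **`∃ c > 0` form**: the laminate class cannot refute `TopEigHeatCoercivePos q` /
`NegBotEigHeatCoercivePos q` for any real `q > 1`. [ours] -/
theorem heatCoercivePos_isLaminate_gt_one {q : ℝ} (hq : 1 < q) :
    (∃ c : ℝ, 0 < c ∧ HeatCoerciveOn (d := Fin 3) IsLaminate (torusTopEigMoment q) c) ∧
      ∃ c : ℝ, 0 < c ∧ HeatCoerciveOn (d := Fin 3) IsLaminate (torusNegBotEigMoment q) c :=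
  ⟨⟨_, vlamRate_pos hq, (heatCoerciveOn_isLaminate_gt_one hq).1⟩,
    ⟨_, vlamRate_pos hq, (heatCoerciveOn_isLaminate_gt_one hq).2⟩⟩

/-- **Kill lemma**: a field violating coercivity of either core at a rate `c ≤ vlamRate q` is not a
laminate (`q > 1`). [ours] -/
theorem kill_not_isLaminate_gt_one {q : ℝ} (hq : 1 < q) {c : ℝ} (hc : c ≤ vlamRate q)
    {v : UnitAddTorus (Fin 3) → EuclideanSpace ℝ (Fin 3)}
    (hv : heatDissipation (torusTopEigMoment q) v < c * torusTopEigMoment q v ∨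
      heatDissipation (torusNegBotEigMoment q) v < c * torusNegBotEigMoment q v) : ¬ IsLaminate v := by
  rintro ⟨k, A, hk, hdiv, rfl⟩
  obtain ⟨h1, h2⟩ := vlaminate_coercive_gt_one A hq hk hdiv
  have hΦ1 := torusTopEigMoment_nonneg q (lamV k A)
  have hΦ2 := torusNegBotEigMoment_nonneg q (lamV k A)
  rcases hv with h | h
  · nlinarith [mul_le_mul_of_nonneg_right hc hΦ1]
  · nlinarith [mul_le_mul_of_nonneg_right hc hΦ2]

end TopEigLaminate
end Summit.NavierStokesRegularity.FunctionalMining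
end
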